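import Summits.NavierStokesRegularity.NavierStokesRegularity.Theorems.ScenarioCensusRowF1ScalingTopKill
import HarnessLib

/-!
# LINE 40 «scaling-top» port, part 3/4: §5 THE FLOORS, proved (`similarFloor_holds`, `dssFloor_holds`, `homogeneousFloor_holds`; units `le_of_units`; LINE 39's
# `eventually_forall_not_of_not_frequently` / LINE 37's `zoom_units` BY NAME), the census ROWS as corollaries (`row_of_floor`, `rowF1ss_holds`, `rowF1ds_holds`, `rowF1hs_holds`),
# the threshold `similarLevel` and the floor read pointwise

Re-homed for the scenario census (typer seat ns-census-typer-1 g10; the cells «similar-pocket snapshots» / F1ds / F1hs and the floors SSF / DSF / HF are MEMBERS OF RECORD «DECIDED IN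
KERNEL IN FILES» of row F1 (item 85: critic idea-crit-3 g10 PASS no price tier B 12:32:22Z; ref PRE-CHECK ✓ §19.17; lead label); this port makes them TREE-decided): VERBATIM PORT of
ns-idea-3 LINE 40 «scaling-top», `pub/ideators/ns-idea-3/lines/scaling-top/line-scaling-top.lean` sha16 3435a148b4d1d87d (1360 l., lean check rc 0, 0 sorry), split for the 400-line
rule into `ScenarioCensusRowF1ScalingTop` (§1–§4a) → `…ScalingTopKill` (§4b) → `…ScalingTopFloors` (§5) → `…ScalingTopRows` (§6–§7 + census KEYS).  Lean text VERBATIM in namespace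
`…Theorems.ScenarioCensus.ScalingTop` (the line's `…Cruxes.ScenarioCensusRowF1.ScalingTopLine` re-homed); port edits: the frame restated VERBATIM by the line from LINES 34–39 (`topSet`,
`HasTypeIConstant`, `snapLevel`, `exists_fast_at`, `sqrt_mul_sq_mul`, `limitClass_compact`, `exists_level_of_limitKill`, `exists_witnessZoom_package`, `zoom_units`,
`eventually_forall_not_of_not_frequently`) is taken BY NAME from the landed two-time-top / one-level-top / snapshot-top / needle-top / echo-top ports, and the alias `centre_mem` is the tree's `IsTypeIAncientMild.comp_add_right` (Literature, BY NAME); the bookkeeping lemma `tendstoLocallyUniformly_comp_of_tendsto` (a twin of a landed lemma in a route-cone module) is not re-declared, its 3-line proof is inlined in `tendsto_eval`; `rowF1ss_holds` is spelled `: ScalingTop.Row_F1ss` (same statement; the unqualified text coincides with «stretched-top»'s `rowF1ss_holds`); `@[conjecture]` on the residual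
`SimilarCollapse` (≡ `ScenarioCensus.Row_F1`, OPEN); one-line docstrings added where missing (gate lint).  Statements untouched; the line's row keeps its name `ScalingTop.Row_F1ss`,
only its census KEY is spelled `Row_F1sps` because `ScenarioCensus.Row_F1ss` is «stretched-top»'s cell F1ss (slot 9, `ScenarioCensusRowF1StretchedTop.lean` :231).

No census VALUE is moved here (row F1 stays OPEN-WITH-LINE; the members become TREE-decided by name); NS regularity is NOT proved; `Row_F1` is untouched (zero
movement, `similarCollapse_iff_rowF1`); no summit statement is proved by this file. Lemmas that restate already-landed tree declarations are taken BY NAME (gate lint `dedup.landed`): `topSet` = `TwoTimeTop.topSet`, `HasTypeIConstant` = `OneLevelTop.HasTypeIConstant`, `snapLevel` = `SnapshotTop.snapLevel`, `exists_fast_at` = `SnapshotTop.exists_fast_at`, `sqrt_mul_sq_mul` = `SnapshotTop.sqrt_mul_sq_mul`, `limitClass_compact` = `NeedleTop.limitClass_compact`, `exists_level_of_limitKill` = `NeedleTop.exists_level_of_limitKill`, `zoom_units` = `NeedleTop.zoom_units`, `exists_witnessZoom_package` = `EchoTop.exists_witnessZoom_package`, `eventually_forall_not_of_not_frequently` = `EchoTop.eventually_forall_not_of_not_frequently`,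 `centre_mem` = `IsTypeIAncientMild.comp_add_right`.
-/

-- the summit and its single problem share the name `NavierStokesRegularity` (D-0017 nested layout)
set_option linter.dupNamespace false

noncomputable section

open MeasureTheory Set Function Filter TopologicalSpace Metric
open scoped Topology NNReal ENNReal InnerProductSpace

namespace Summit.NavierStokesRegularity.NavierStokesRegularity.Theorems.ScenarioCensus.ScalingTop

open Literature.Analysis Literature.Analysis.FluidPDE
open Summit.NavierStokesRegularity.NavierStokesRegularity.Theorems
open Summit.NavierStokesRegularity.NavierStokesRegularity.Theses
open Summit.NavierStokesRegularity.NavierStokesRegularity.Theorems.LocalHelicityTubeDoorFrobeniusProfileRigidityHelicalSlice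

/-! ## §5 THE FLOORS (universal over fast points, every level), proved; the census ROWS as corollaries (Leray's every-time floor);
the definite similar threshold -/

-- `zoom_units`: the line restates the tree's `NeedleTop.zoom_units`; taken BY NAME (gate lint dedup.landed).

-- `eventually_forall_not_of_not_frequently`: the line restates the tree's `EchoTop.eventually_forall_not_of_not_frequently`; taken BY NAME (gate lint dedup.landed).

/-- Dimensionless bookkeeping: `c√ν · D ≤ Λ√ν ⇒ c · D ≤ Λ`. -/
theorem le_of_units {ν c D Λ : ℝ} (hν : 0 < ν) (h : c * Real.sqrt ν * D ≤ Λ * Real.sqrt ν) : c * D ≤ Λ := by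
  have h2 : c * D * Real.sqrt ν ≤ Λ * Real.sqrt ν := by
    linarith [h, mul_comm (Real.sqrt ν) D, mul_assoc c (Real.sqrt ν) D, mul_assoc c D (Real.sqrt ν)]
  exact le_of_mul_le_mul_right h2 (Real.sqrt_pos.2 hν)

/-- **THE SIMILAR FLOOR holds** (witness package of §3 + similar level of §4; the pocket read in the zoom is a similar defect of the zoom
with the SAME dimensionless apex `b_j`, and the similar limit carries it to the limit). -/
theorem similarFloor_holds : SimilarFloor := by
  intro M Λ l₁ l₂ A a hΛ hl₁ hl ha
  obtain ⟨Λ₁, hΛ₁, hlev⟩ := exists_similarLevel M l₁ l₂ A a hl₁ hl ha hΛ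
  refine ⟨Λ₁, hΛ₁, ?_⟩
  intro ν T hν hT u p hsol hLH hdec hM
  refine EchoTop.eventually_forall_not_of_not_frequently fun hfreq => ?_
  obtain ⟨c, x, W, hcpos, -, hW, hQ, -, -, -, hlu, hnorm⟩ :=
    EchoTop.exists_witnessZoom_package hν hT hsol hLH hdec hM hfreq
  apply hlev W hW hnorm
  set F : ℕ → ℝ → E3 → E3 := fun j s y => (c j * 1) • u (T + c j ^ 2 * ν * s) (x j + (c j * ν) • y) with hF
  have hpk : ∀ j, ∃ b ∈ closedBall (0 : E3) A, ∀ lam ∈ Icc l₁ l₂, ∀ w ∈ closedBall (0 : E3) a,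
      ‖F j (-1) (b + w) - lam • F j (-lam ^ 2) (b + lam • w)‖ ≤ Λ₁ := by
    intro j
    obtain ⟨hunit, hsq⟩ := NeedleTop.zoom_units (T := T) hν hcpos j
    obtain ⟨b, hb, hpock⟩ := hQ j
    refine ⟨b, mem_closedBall_zero_iff.2 hb, fun lam hlam w hw => ?_⟩
    have h1 := hpock lam hlam w (mem_closedBall_zero_iff.1 hw)
    have etime : T - lam ^ 2 * (T - (T + c j ^ 2 * ν * (-1))) = T + c j ^ 2 * ν * (-lam ^ 2) := by ring
    rw [hsq, hunit, etime] at h1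
    simp only [hF]
    rw [smul_comm lam (c j * 1), ← smul_sub, norm_smul, Real.norm_eq_abs, abs_of_pos (mul_pos (hcpos j) one_pos),
      mul_one]
    exact le_of_units hν h1
  exact similar_limit hl₁ (fun s hs => continuous_slice' hW hs) (fun s hs => hlu s hs) tendsto_const_nhds hpk

/-- **THE DSS-PAIR FLOOR holds** (witness package + DSS level; the window instants `τ = T + c_j²ν s`, `s ∈ [−K, −1]`). -/
theorem dssFloor_holds : DssFloor := by
  intro M Λ lam lam' K A a hΛ hlam hlam' hirr hK ha
  obtain ⟨Λ₁, hΛ₁, hlev⟩ := exists_dssLevel M lam lam' K A a hlam hlam' hirr hK ha hΛ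
  refine ⟨Λ₁, hΛ₁, ?_⟩
  intro ν T hν hT u p hsol hLH hdec hM
  refine EchoTop.eventually_forall_not_of_not_frequently fun hfreq => ?_
  obtain ⟨c, x, W, hcpos, -, hW, hQ, -, -, -, hlu, hnorm⟩ :=
    EchoTop.exists_witnessZoom_package hν hT hsol hLH hdec hM hfreq
  apply hlev W hW hnorm
  set F : ℕ → ℝ → E3 → E3 := fun j s y => (c j * 1) • u (T + c j ^ 2 * ν * s) (x j + (c j * ν) • y) with hF
  have hpk : ∀ j, ∃ b ∈ closedBall (0 : E3) A, ∀ s ∈ Icc (-K) (-1), ∀ w ∈ closedBall (0 : E3) a,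
      ‖F j s (b + w) - lam • F j (lam ^ 2 * s) (b + lam • w)‖ ≤ Λ₁ ∧
      ‖F j s (b + w) - lam' • F j (lam' ^ 2 * s) (b + lam' • w)‖ ≤ Λ₁ := by
    intro j
    obtain ⟨hunit, hsq⟩ := NeedleTop.zoom_units (T := T) hν hcpos j
    obtain ⟨b, hb, hwin⟩ := hQ j
    refine ⟨b, mem_closedBall_zero_iff.2 hb, fun s hs w hw => ?_⟩
    have hc2 : 0 < c j ^ 2 * ν := mul_pos (pow_pos (hcpos j) 2) hν
    have hτ : T + c j ^ 2 * ν * s ∈ Icc (T - K * (T - (T + c j ^ 2 * ν * (-1)))) (T + c j ^ 2 * ν * (-1)) := by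
      constructor <;> nlinarith [hs.1, hs.2]
    have h12 := hwin _ hτ w (mem_closedBall_zero_iff.1 hw)
    have etime : ∀ l : ℝ, T - l ^ 2 * (T - (T + c j ^ 2 * ν * s)) = T + c j ^ 2 * ν * (l ^ 2 * s) := fun l => by ring
    rw [hsq, hunit, etime lam, etime lam'] at h12
    simp only [hF]
    rw [smul_comm lam (c j * 1), smul_comm lam' (c j * 1), ← smul_sub, ← smul_sub, norm_smul, norm_smul, Real.norm_eq_abs,
      abs_of_pos (mul_pos (hcpos j) one_pos), mul_one]
    exact ⟨le_of_units hν h12.1, le_of_units hν h12.2⟩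
  exact dss_limit hlam hlam' (fun s hs => continuous_slice' hW hs) (fun s hs => hlu s hs) tendsto_const_nhds hpk

/-- **THE HOMOGENEOUS FLOOR holds** (witness package + homogeneity level; slice `−1` only). -/
theorem homogeneousFloor_holds : HomogeneousFloor := by
  intro M Λ μ₁ μ₂ A a hΛ hμ ha
  obtain ⟨Λ₁, hΛ₁, hlev⟩ := exists_homLevel M μ₁ μ₂ A a hμ ha hΛ
  refine ⟨Λ₁, hΛ₁, ?_⟩
  intro ν T hν hT u p hsol hLH hdec hM
  refine EchoTop.eventually_forall_not_of_not_frequently fun hfreq => ?_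
  obtain ⟨c, x, W, hcpos, -, hW, hQ, -, -, -, hlu, hnorm⟩ :=
    EchoTop.exists_witnessZoom_package hν hT hsol hLH hdec hM hfreq
  apply hlev W hW hnorm
  set F : ℕ → ℝ → E3 → E3 := fun j s y => (c j * 1) • u (T + c j ^ 2 * ν * s) (x j + (c j * ν) • y) with hF
  have hpk : ∀ j, ∃ b ∈ closedBall (0 : E3) A, ∀ μ ∈ Icc μ₁ μ₂, ∀ w ∈ closedBall (0 : E3) a,
      ‖μ • F j (-1) (b + μ • w) - F j (-1) (b + w)‖ ≤ Λ₁ := by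
    intro j
    obtain ⟨hunit, hsq⟩ := NeedleTop.zoom_units (T := T) hν hcpos j
    obtain ⟨b, hb, hpock⟩ := hQ j
    refine ⟨b, mem_closedBall_zero_iff.2 hb, fun μ hμ w hw => ?_⟩
    have h1 := hpock μ hμ w (mem_closedBall_zero_iff.1 hw)
    rw [hsq, hunit] at h1
    simp only [hF]
    rw [smul_comm μ (c j * 1), ← smul_sub, norm_smul, Real.norm_eq_abs, abs_of_pos (mul_pos (hcpos j) one_pos), mul_one]
    exact le_of_units hν h1
  exact hom_limit (continuous_slice' hW (by norm_num)) (hlu (-1) (by norm_num)) tendsto_const_nhds hpk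

/-- Census-row bookkeeping (LINE 39 pattern): a floor at Leray's level `c_S` and Leray's every-time lower rate give the row. -/
theorem row_of_floor {ν T : ℝ} (hν : 0 < ν) (hT : 0 < T) {u : ℝ → E3 → E3} {p : ℝ → E3 → ℝ}
    (hsol : IsClassicalNSSolutionOn (Ico 0 T) ν 0 u p) (hLH : IsLerayHopfOn T ν 0 (u 0) u)
    (hdec : HasRapidSpatialDecay (u 0)) {E : ℝ → E3 → Prop}
    (hev : ∀ᶠ t in 𝓝[<] T, ∀ x ∈ TwoTimeTop.topSet ν T u SnapshotTop.snapLevel t, ¬ E t x)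
    (hfreq : ∃ᶠ t in 𝓝[<] T, ∀ x ∈ TwoTimeTop.topSet ν T u SnapshotTop.snapLevel t, E t x) : HasSmoothExtensionPast ν 0 u T := by
  by_contra hmax
  have hIco : ∀ᶠ t in 𝓝[<] T, t ∈ Ico (0 : ℝ) T := Ico_mem_nhdsLT hT
  obtain ⟨t, hall, hnone, htI⟩ := (hfreq.and_eventually (hev.and hIco)).exists
  obtain ⟨x, hx⟩ := SnapshotTop.exists_fast_at hν hT hsol hLH hdec hmax htI
  exact hnone x hx.le (hall x hx.le)

/-- **ROW F1ss holds** (similar floor at `c_S` + Leray's every-time floor). -/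
theorem rowF1ss_holds : ScalingTop.Row_F1ss := by
  intro M l₁ l₂ A a hl₁ hl ha
  obtain ⟨ε, hε, hfl⟩ := similarFloor_holds M SnapshotTop.snapLevel l₁ l₂ A a SnapshotTop.snapLevel_pos hl₁ hl ha
  exact ⟨ε, hε, fun ν T hν hT u p hsol hLH hdec hM hfreq =>
    row_of_floor hν hT hsol hLH hdec (hfl ν T hν hT u p hsol hLH hdec hM) hfreq⟩

/-- **ROW F1ds holds** (DSS-pair floor at `c_S`). -/
theorem rowF1ds_holds : Row_F1ds := by
  intro M lam lam' K A a hlam hlam' hirr hK ha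
  obtain ⟨ε, hε, hfl⟩ := dssFloor_holds M SnapshotTop.snapLevel lam lam' K A a SnapshotTop.snapLevel_pos hlam hlam' hirr hK ha
  exact ⟨ε, hε, fun ν T hν hT u p hsol hLH hdec hM hfreq =>
    row_of_floor hν hT hsol hLH hdec (hfl ν T hν hT u p hsol hLH hdec hM) hfreq⟩

/-- **ROW F1hs holds** (homogeneous floor at `c_S`). -/
theorem rowF1hs_holds : Row_F1hs := by
  intro M μ₁ μ₂ A a hμ ha
  obtain ⟨ε, hε, hfl⟩ := homogeneousFloor_holds M SnapshotTop.snapLevel μ₁ μ₂ A a SnapshotTop.snapLevel_pos hμ ha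
  exact ⟨ε, hε, fun ν T hν hT u p hsol hLH hdec hM hfreq =>
    row_of_floor hν hT hsol hLH hdec (hfl ν T hν hT u p hsol hLH hdec hM) hfreq⟩

/-- **The definite similar threshold `similarLevel M Λ l₁ l₂ A a`** — a witness of the floor (ineffective: compactness); `1` off the
admissible parameter range. -/
def similarLevel (M Λ l₁ l₂ A a : ℝ) : ℝ :=
  if h : 0 < Λ ∧ 0 < l₁ ∧ l₁ < l₂ ∧ 0 < a then Classical.choose (similarFloor_holds M Λ l₁ l₂ A a h.1 h.2.1 h.2.2.1 h.2.2.2) else 1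

/-- The definite similar-pocket threshold is positive. -/
theorem similarLevel_pos (M Λ l₁ l₂ A a : ℝ) : 0 < similarLevel M Λ l₁ l₂ A a := by
  unfold similarLevel
  split_ifs with h
  · exact (Classical.choose_spec (similarFloor_holds M Λ l₁ l₂ A a h.1 h.2.1 h.2.2.1 h.2.2.2)).1
  · exact one_pos

/-- **THE SIMILAR FLOOR, read out at its definite threshold**: in a Clay solution with Type-I constant `M`, for all late instants `t`, EVERY
`Λ`-fast point `x` and EVERY candidate apex `x + ℓb`, `‖b‖ ≤ A`, admit a factor `λ ∈ [l₁, l₂]` and a point `w`, `‖w‖ ≤ a`, at which the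
snapshot FAILS to be the `λ`-rescaling of the earlier one: `√(T − t)‖u(t, x_* + ℓw) − λ u(T − λ²(T − t), x_* + λℓw)‖ > similarLevel · √ν`. -/
theorem similarFloor_read {M Λ l₁ l₂ A a : ℝ} (hΛ : 0 < Λ) (hl₁ : 0 < l₁) (hl : l₁ < l₂) (ha : 0 < a)
    {ν T : ℝ} (hν : 0 < ν) (hT : 0 < T) {u : ℝ → E3 → E3} {p : ℝ → E3 → ℝ}
    (hsol : IsClassicalNSSolutionOn (Ico 0 T) ν 0 u p) (hLH : IsLerayHopfOn T ν 0 (u 0) u)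
    (hdec : HasRapidSpatialDecay (u 0)) (hM : OneLevelTop.HasTypeIConstant ν T M u) :
    ∀ᶠ t in 𝓝[<] T, ∀ x ∈ TwoTimeTop.topSet ν T u Λ t, ∀ b : E3, ‖b‖ ≤ A →
      ∃ lam ∈ Icc l₁ l₂, ∃ w : E3, ‖w‖ ≤ a ∧
        similarLevel M Λ l₁ l₂ A a * Real.sqrt ν <
          Real.sqrt (T - t) * ‖u t (x + (Real.sqrt (ν * (T - t))) • (b + w))
            - lam • u (T - lam ^ 2 * (T - t)) (x + (Real.sqrt (ν * (T - t))) • (b + lam • w))‖ := by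
  have h : 0 < Λ ∧ 0 < l₁ ∧ l₁ < l₂ ∧ 0 < a := ⟨hΛ, hl₁, hl, ha⟩
  have hspec := (Classical.choose_spec (similarFloor_holds M Λ l₁ l₂ A a h.1 h.2.1 h.2.2.1 h.2.2.2)).2
    ν T hν hT u p hsol hLH hdec hM
  have hlev : similarLevel M Λ l₁ l₂ A a =
      Classical.choose (similarFloor_holds M Λ l₁ l₂ A a h.1 h.2.1 h.2.2.1 h.2.2.2) := by
    unfold similarLevel
    rw [dif_pos h]
  filter_upwards [hspec] with t ht x hx b hb
  by_contra hno
  push Not at hno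
  exact ht x hx ⟨b, hb, fun lam hlam w hw => by have h' := hno lam hlam w hw; rwa [hlev] at h'⟩

end Summit.NavierStokesRegularity.NavierStokesRegularity.Theorems.ScenarioCensus.ScalingTop

end
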